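import Summits.QuantumFields.BalabanUV.Beta.FP.PerfectColumnMass
import Summits.QuantumFields.BalabanUV.Beta.FP.HorizontalBookkeepingTailLetters
import Summits.QuantumFields.BalabanUV.Beta.FP.StepLawKHolds

/-!
# `BalabanUV.Beta.FP.PerfectColumnTransportTail` — road «FP» for binder row D1, JUNCTION of row **N7/IPROF-UNIF** (route (γ), `FP/PerfectColumnMass`) with row
# **N7/H3-BOOK (b-T)** (letters interface `FP/HorizontalBookkeepingTailLetters`): for the PERFECT MINIMISER COLUMNS `w := colOf (KPerf Lc (sfStep Lc) (smStep 3 Lc) m)`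
# at `N := Lc^m`, the weighted tail-transport difference (T2) is summable on `ℤ⁴` with an `m`-FREE bound, for EVERY `m ≥ 1`, given ONLY the decay rows `hK`∕`hdK`
# of the transported kernel `K` — no hypothesis on the columns remains

NOT IN PRINT; OUR BOOKKEEPING (three tree theorems composed BY NAME).  HONEST FRAMING (cell contract, verbatim): «discharging `BetaPertH` makes Bałaban's UV stability
UNCONDITIONAL — a real constructive-QFT result; it is NOT the continuum limit and NOT the Clay problem.»  HONEST DEPENDENCY (verbatim): «continuum YM on T⁴ ⇐ BetaPertH ∧ nine
spine estimates (0/9 proved); BetaPertH ⇐ (D1) ∧ (D4) ∧ CAP+tail; G-an2-4 gates asym, D1 and NE2/3/4.»  THIS MODULE DISCHARGES NOTHING of (b3′)∕(b4′) ∕ `hbook` ∕ `hasym` ∕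
H4-ASM ∕ D1: it pins the instantiation at which row IPROF-UNIF's output is consumed.  Cross-lane filing by an idle G-an2-4 swarm seat (unit `b2b-balaban-gan24-formalise-leaf-04`,
gen 38) on its own row's seam with d1-formalise-leaf-02's interface (owner d1-p3's `HOME/b2b-balaban-beta-d1-p3/LEAVES-FP.md`).  NEVER «G-an2-4 closed»; NOT D1, NOT BetaPertH,
NOT continuum, NOT Clay.

CONTENT ([our object]; 0 def, 0 cited fact, 0 sorry):
* `transportLetters_perfCol`: ALL FIVE transport hypotheses `hw0`∕`hw1`∕`hwA`∕`hwE`∕`hwEb` of `HorizontalBookkeepingEndLetters.abs_secondMoment_sub_window_le_of_expL1` for the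
  perfect columns, every `m ≥ 1`, ONE `(δ, c)` (`StepLawKHolds.entryHyps_perfCol_holds` + `PerfectColumnMass.expL1_colOf_KPerf`).
* `constReproSum_colOf_KPerf`: the exact coset sums `hw0` of the perfect columns for every `m ≥ 1` (`StepLawKHolds.entryHyps_perfCol_holds` at the zero partner kernel — its
  `const` field does not involve the partner).
* **`transport_tail_perfCol`**: `∃ δ c, 0 < δ ∧ 0 ≤ c ∧ ∀ m ≥ 1, ∀ a b μ ν`, with `N = Lc^m`, `w = colOf (KPerf … m)` and
  `A_E = 4⁷·(16·C·(c·e^δ)² + C) + (5∕4)⁷·(C·(c·e^δ)·(128·(4∕3)⁷·(c·e^δ∕δ) + 4096·16⁷·(5040·c·e^δ∕δ⁷)))` (free of `m`):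
  the summand `g v = (v_μ v_ν)·(N⁸·dressedEntry w (K − truncK K N) (N•v) a b − N⁶·(K − truncK K N) a b (N•v))` obeys `|g v| ≤ A_E∕(‖v‖∞+1)⁵`, is `Summable`,
  `|Σ' g| ≤ 161·A_E`, and `|Σ_{v∈S} g v| ≤ 161·A_E` for every finite `S` — `HorizontalBookkeepingTailLetters.summable_weight_transport_tail_sub_of_expL1` with `hwE`∕`hwEb`
  := `PerfectColumnMass.expL1_colOf_KPerf` and `hw0` := `constReproSum_colOf_KPerf`.

ABSOLUTE RULE (cell, verbatim): «No internally-minted statement may enter as a cited fact. Every hypothesis is either kernel-proved in this package or a verbatim quotation of a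
PUBLISHED theorem with page reference.»  Nothing is cited; the only hypotheses left are the transported kernel's decay rows `hK`∕`hdK` (road FP's H2 object).
-/

noncomputable section

open Literature.MathematicalPhysics.QuantumFieldTheory.Balaban1983to89
open Literature.MathematicalPhysics.QuantumFieldTheory.Balaban1983to89.Beta
open DecimatedMomentSummable (ConstReproSum LinReproSum AbsMoment₂)
open B12Sec2to5 (l1)
open DressedMomentNormalisation (EKer dressedEntry)
open DyadicShell (Pt supNorm)
open Summit.QuantumFields.BalabanUV.Beta.GAN24.CombesThomas (sfStep smStep)
open Summit.QuantumFields.BalabanUV.Beta.FP.PerfectObjectsT (KPerf)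
open Summit.QuantumFields.BalabanUV.Beta.FP.TransportInfinityM (colOf)
open Summit.QuantumFields.BalabanUV.Beta.FP.HorizontalBookkeeping (truncK)
open Summit.QuantumFields.BalabanUV.Beta.FP.PerfectColumnMass (expL1_colOf_KPerf)
open Summit.QuantumFields.BalabanUV.Beta.FP.HorizontalBookkeepingTailLetters (summable_weight_transport_tail_sub_of_expL1)
open Summit.QuantumFields.BalabanUV.Beta.FP.StepLawKHolds (entryHyps_perfCol_holds)

namespace Summit.QuantumFields.BalabanUV.Beta.FP.PerfectColumnTransportTail

variable {Lc : ℕ} [NeZero Lc]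

/-- [our object] **THE EXACT COSET SUMS OF THE PERFECT MINIMISER COLUMNS, EVERY `m ≥ 1`**: `ConstReproSum (Lc^m) (colOf (KPerf … m) κ l) (δ_{κl}·((Lc^m)^5)⁻¹)` — the
`const` field of `StepLawKHolds.entryHyps_perfCol_holds`, read at the zero partner kernel (the field does not involve the partner). -/
theorem constReproSum_colOf_KPerf (hLc : 2 ≤ Lc) {m : ℕ} (hm : 1 ≤ m) (κ l : Fin 4) :
    ConstReproSum (Lc ^ m) (colOf (KPerf (d := 3) Lc (sfStep Lc) (smStep 3 Lc) m) κ l)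
      (if κ = l then ((((Lc ^ m : ℕ) : ℝ) ^ (4 + 1))⁻¹) else 0) :=
  (entryHyps_perfCol_holds (Lc := Lc) hLc hm (𝒯 := (0 : EKer 4)) (fun _ _ => by simp [AbsMoment₂, summable_zero])
    (fun _ _ => hasSum_zero) (fun _ _ _ => by simp)).const κ l

/-- **EVERY TRANSPORT LETTER OF THE HORIZONTAL END HOLDS FOR THE PERFECT MINIMISER COLUMNS, EVERY `m ≥ 1`** [our object] (`d = 3`, `2 ≤ Lc`): with ONE pair `(δ, c)`,
for all `m ≥ 1` and `w = colOf (KPerf Lc (sfStep Lc) (smStep 3 Lc) m)`, `N = Lc^m`: the five transport hypotheses `hw0` (exact coset sums), `hw1` (linear reproduction, some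
constants `Cw`), `hwA` (absolutely summable second moments), `hwE`∕`hwEb` (exponentially weighted ℓ¹ mass `≤ c∕N`) of
`HorizontalBookkeepingEndLetters.abs_secondMoment_sub_window_le_of_expL1` — `StepLawKHolds.entryHyps_perfCol_holds` (fields `const`∕`lin`∕`absW`) and
`PerfectColumnMass.expL1_colOf_KPerf`.  (The END's remaining inputs — `K`'s rows, (H1), the defect size `U₀`, the window germ — are the road's other rows.) -/
theorem transportLetters_perfCol (hLc : 2 ≤ Lc) : ∃ δ c : ℝ, 0 < δ ∧ 0 ≤ c ∧ ∀ m, 1 ≤ m →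
    (∀ κ l, ConstReproSum (Lc ^ m) (colOf (KPerf (d := 3) Lc (sfStep Lc) (smStep 3 Lc) m) κ l)
        (if κ = l then ((((Lc ^ m : ℕ) : ℝ) ^ (4 + 1))⁻¹) else 0)) ∧
    (∃ Cw : Fin 4 → Fin 4 → Fin 4 → ℝ, ∀ κ l, LinReproSum (Lc ^ m) (colOf (KPerf (d := 3) Lc (sfStep Lc) (smStep 3 Lc) m) κ l) (Cw κ l)) ∧
    (∀ κ l, AbsMoment₂ (colOf (KPerf (d := 3) Lc (sfStep Lc) (smStep 3 Lc) m) κ l)) ∧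
    (∀ κ l, Summable fun x : Pt => Real.exp (δ / ((Lc ^ m : ℕ) : ℝ) * l1 x) * |colOf (KPerf (d := 3) Lc (sfStep Lc) (smStep 3 Lc) m) κ l x|) ∧
    (∀ κ l, ∑' x : Pt, Real.exp (δ / ((Lc ^ m : ℕ) : ℝ) * l1 x) * |colOf (KPerf (d := 3) Lc (sfStep Lc) (smStep 3 Lc) m) κ l x| ≤
        c / ((Lc ^ m : ℕ) : ℝ)) := by
  obtain ⟨δ, c, hδ, hc, h⟩ := expL1_colOf_KPerf (Lc := Lc) hLc
  refine ⟨δ, c, hδ, hc, fun m hm => ?_⟩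
  have hE := entryHyps_perfCol_holds (Lc := Lc) hLc hm (𝒯 := (0 : EKer 4)) (fun _ _ => by simp [AbsMoment₂, summable_zero])
    (fun _ _ => hasSum_zero) (fun _ _ _ => by simp)
  classical
  exact ⟨hE.const, ⟨fun κ l => Classical.choose (hE.lin κ l), fun κ l => Classical.choose_spec (hE.lin κ l)⟩, hE.absW,
    fun κ l => (h m hm κ l).1, fun κ l => (h m hm κ l).2⟩

/-- **THE TAIL-TRANSPORT COMPARISON (T2) FOR THE PERFECT MINIMISER COLUMNS, EVERY `m ≥ 1`, `m`-FREE CONSTANT** [our object] (`d = 3`, `2 ≤ Lc`): for a transported kernel `K`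
with the decay rows `|K c′ e t| ≤ C∕(‖t‖∞+1)⁶`, `|K c′ e (t+e_i) − K c′ e t| ≤ C∕(‖t‖∞+1)⁷`, there are `δ > 0`, `c ≥ 0` (row IPROF-UNIF's, `FP/PerfectColumnMass.expL1_colOf_KPerf`)
such that for every `m ≥ 1` and all `a b μ ν`, at `N = Lc^m` and `w = colOf (KPerf Lc (sfStep Lc) (smStep 3 Lc) m)`, the weighted difference
`g v = (v_μ·v_ν)·(N⁸·dressedEntry w (K − truncK K N) (N•v) a b − N⁶·(K − truncK K N) a b (N•v))` satisfies `|g v| ≤ A_E∕(‖v‖∞+1)⁵`, `Summable g`, `|Σ' g| ≤ 161·A_E` and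
`|Σ_{v∈S} g v| ≤ 161·A_E` for every finite `S`, with the DISPLAYED `m`-free `A_E` of `HorizontalBookkeepingTailLetters.summable_weight_transport_tail_sub_of_expL1`. -/
theorem transport_tail_perfCol (hLc : 2 ≤ Lc) {K : EKer 4} {C : ℝ}
    (hK : ∀ c' e (t : Pt), |K c' e t| ≤ C / ((supNorm t : ℝ) + 1) ^ 6)
    (hdK : ∀ c' e (t : Pt) (i : Fin 4), |K c' e (t + Pi.single i 1) - K c' e t| ≤ C / ((supNorm t : ℝ) + 1) ^ 7) :
    ∃ δ c : ℝ, 0 < δ ∧ 0 ≤ c ∧ ∀ m, 1 ≤ m → ∀ a b μ ν : Fin 4,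
      let AE : ℝ := (4 : ℝ) ^ 7 * (16 * C * (c * Real.exp δ) ^ 2 + C)
          + (5 / 4 : ℝ) ^ 7 * (C * (c * Real.exp δ) * (128 * (4 / 3 : ℝ) ^ 7 * (c * Real.exp δ / δ) + 4096 * 16 ^ 7 * (5040 * c * Real.exp δ / δ ^ 7)))
      let g : Pt → ℝ := fun v => ((v μ * v ν : ℤ) : ℝ)
            * (((Lc ^ m : ℕ) : ℝ) ^ 8 * dressedEntry (colOf (KPerf (d := 3) Lc (sfStep Lc) (smStep 3 Lc) m)) (K - truncK K (Lc ^ m))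
                (((Lc ^ m : ℕ) : ℤ) • v) a b
              - ((Lc ^ m : ℕ) : ℝ) ^ 6 * (K - truncK K (Lc ^ m)) a b (((Lc ^ m : ℕ) : ℤ) • v))
      (∀ v, |g v| ≤ AE / ((supNorm v : ℝ) + 1) ^ 5)
        ∧ Summable g ∧ |∑' v, g v| ≤ 161 * AE ∧ ∀ S : Finset Pt, |∑ v ∈ S, g v| ≤ 161 * AE := by
  obtain ⟨δ, c, hδ, hc, h⟩ := expL1_colOf_KPerf (Lc := Lc) hLc
  refine ⟨δ, c, hδ, hc, fun m hm a b μ ν => ?_⟩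
  have hN : 1 ≤ Lc ^ m := Nat.one_le_pow m Lc (Nat.pos_of_ne_zero (NeZero.ne Lc))
  exact summable_weight_transport_tail_sub_of_expL1 (N := Lc ^ m) hN hδ hK hdK (constReproSum_colOf_KPerf hLc hm)
    (fun κ l => (h m hm κ l).1) (fun κ l => (h m hm κ l).2) a b μ ν

end Summit.QuantumFields.BalabanUV.Beta.FP.PerfectColumnTransportTail

end
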